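import Literature.MathematicalPhysics.QuantumLattice.StrongExpDecaySlabCover
import Literature.MathematicalPhysics.QuantumLattice.StrongExpDecayWindowInfluence
import Literature.MathematicalPhysics.QuantumLattice.CentreSymmetryDobrushin
import Literature.Probability.LatticeModels.DobrushinShlosmanUniquenessBulkFrozen
import Mathlib.Analysis.SpecialFunctions.Exp
import HarnessLib

/-!
# Chatterjee's Theorem 2.4, first assertion: exponential decay of correlations under arbitrary boundary
# conditions implies unbroken centre symmetry (CMP 385 (2021)) — every compact gauge group

S. Chatterjee, *A probabilistic mechanism for quark confinement*, Commun. Math. Phys. **385** (2021) 1007–1039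
[Chatterjee2021], **Theorem 2.4** (first assertion): «Consider the lattice gauge theory defined in Subsection 2.1.
Suppose that it satisfies exponential decay of correlations under arbitrary boundary conditions, according to
Definition 2.3. Then it has unbroken center symmetry.» The printed proof (§§7–12): Cor. 7.6 (a change of the
boundary condition of a cube on a set `A` of boundary links moves the law of the links `r`-far from `A` by
`≤ C₁|A|r^{d−1}e^{−C₂r}` in total variation) ⇒ Lemma 8.1 (a coupling of two cube theories) ⇒ §§9–11 (iterating
the «global update map», a uniformly random cube of the slab, Lemmas 9.1, 10.1, 11.1) ⇒ §12 ¶1 (the finite-slab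
laws forget the spatial boundary condition, hence the infinite slab has a unique Gibbs measure under every
boundary condition, and «uniqueness of the Gibbs measure trivially implies that center symmetry cannot be
spontaneously broken»).

This file completes the tree's DERIVATIVE- AND COUPLING-FREE rendering of that proof, valid for EVERY compact
metrisable gauge group `G` and every continuous `ρ` (Chatterjee: closed connected subgroups of `U(n)`; no
connectedness is used anywhere): Cor. 7.4 on cubes (`StrongExpDecayBoundaryInfluenceCube.lean`) ⇒ the
one-boundary-link influence array of the cube kernels with a decaying profile
(`StrongExpDecayWindowInfluence.lean`, the dual of Lemma 8.1) ⇒ Dobrushin–Shlosman's window comparison under the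
AVERAGED condition `C_V` for the system of all full-height cubes of the slab
(`DobrushinShlosmanUniquenessBulk(Frozen).lean`, the dual of §§9–11; combinatorics in
`StrongExpDecaySlabCubes.lean` / `StrongExpDecaySlabCover.lean`) ⇒ uniqueness of the slab Gibbs measure for
every boundary condition at every large height (`subsingleton_slabGibbsMeasures_of_strongExpDecayZd`, §12 ¶1) ⇒
`CentreUnbroken d ρ β` (`centreUnbroken_of_hasStrongExpDecayZd`, via `slabCentreUnbroken_of_subsingleton`).
With the tree's Theorem 2.2 (`chatterjee2021_confinement_of_centreUnbroken_holds`) this is «exponential decay of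
correlations under arbitrary boundary conditions ⇒ confinement `V(R) → ∞`» for every irreducible representation
acting non-trivially on the centre; the AREA-LAW upgrade of Thm. 2.4 (second assertion, §12 Lemma 12.1 ff.) is
not here — the named fact `chatterjee2021_areaLaw_of_strongExpDecay` stays for it.

## The quantitative skeleton (§1)

Influence profile `κ(j) = (2 + 2d e^{4c̄} K₁) e^{2K₂} (j+1)^d e^{−K₂ j/2}` (`c̄ = 4(d−1)C|β|`): it dominates the
trivial bound `2` on the shells `j ≤ 4` and Cor. 7.4's `2d(4r+1)^d e^{4c̄} K₁ e^{−2K₂r}`, `r = ⌊(j−1)/4⌋`, on the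
shells `j ≥ 5`; the received-sum series `Σ_k d(2k+1)^d κ(k)` is summable (`K₂ > 0`) with sum `≤ A`. The averaged
received sum of a link is `≤ 2d(d−1)(n+1)^{d−1} A` while the link lies in `≥ (n−1)^d` windows, so
Dobrushin–Shlosman's ratio is `≤ 1/2` as soon as `n − 1 ≥ 2^{d+1} d(d−1) A` and `n ≥ 3` (Chatterjee's
«if `N` is large enough», proof of Lemma 11.1).

## References
* S. Chatterjee, CMP 385 (2021) 1007–1039, doi:10.1007/s00220-021-04086-y, arXiv:2006.16229: Def. 2.1, Def. 2.3,
  Thm. 2.4, §§7–12.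
* R. L. Dobrushin, S. B. Shlosman, *Constructive criterion for the uniqueness of Gibbs field* (1985), Thm. 1.
* H.-O. Georgii, *Gibbs Measures and Phase Transitions* (2011), Thm. 8.20, §5.1.
-/

noncomputable section

open MeasureTheory Filter Function Finset
open scoped Topology

namespace Literature.MathematicalPhysics.QuantumLattice

open Literature.Probability.LatticeModels
open Literature.Probability.LatticeModels.DobrushinShlosman (measure_eq_of_frozen_dlr_window_bulk)

/-! ### §1 The influence profile and the summability of the received-sum series -/

/-- **The influence profile.** For `d ≥ 1`, `K₁ ≥ 0`, `K₂ > 0` and any `E₀ ≥ 0` there are `κ : ℕ → ℝ≥0` and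
`A ≥ 0` with: `κ j ≥ 2` for `j ≤ 4`; `κ j ≥ E₀ · 2 · d(4r+1)^d · E₀ K₁ e^{−2K₂ r}`, `r = ⌊(j−1)/4⌋`, for `j ≥ 5`;
and `Σ_{k ≤ n} d(2k+1)^d κ k ≤ A` for every `n` (`κ j = (2 + 2dE₀²K₁)e^{2K₂}(j+1)^d e^{−K₂j/2}`, majorised by a
summable `(k+1)^{2d} e^{−K₂k/2}` series). [folklore] -/
private theorem exists_influence_profile {d : ℕ} (E₀ K₁ K₂ : ℝ) (hE₀ : 0 ≤ E₀) (hK₁ : 0 ≤ K₁)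
    (hK₂ : 0 < K₂) :
    ∃ (κ : ℕ → ℝ) (A : ℝ), (∀ j, 0 ≤ κ j) ∧ (∀ j, j ≤ 4 → 2 ≤ κ j) ∧
      (∀ j, 5 ≤ j → E₀ * (2 * ((d * (4 * ((j - 1) / 4) + 1) ^ d : ℕ) *
        (E₀ * (K₁ * Real.exp (-(K₂ * (2 * ((j - 1) / 4 : ℕ)))))))) ≤ κ j) ∧
      0 ≤ A ∧ ∀ n, ∑ k ∈ Finset.range (n + 1), ((d * (2 * k + 1) ^ d : ℕ) : ℝ) * κ k ≤ A := by
  set B : ℝ := (2 + 2 * d * (E₀ * E₀) * K₁) * Real.exp (2 * K₂) with hB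
  have hB2 : 2 * Real.exp (2 * K₂) ≤ B := by
    rw [hB]
    refine mul_le_mul_of_nonneg_right ?_ (Real.exp_nonneg _)
    have : 0 ≤ 2 * (d : ℝ) * (E₀ * E₀) * K₁ := by positivity
    linarith
  have hB0 : 0 ≤ B := by rw [hB]; positivity
  set κ : ℕ → ℝ := fun j => B * ((j + 1 : ℕ) : ℝ) ^ d * Real.exp (-(K₂ / 2) * j) with hκ
  have hκ0 : ∀ j, 0 ≤ κ j := fun j => by simp only [hκ]; positivity
  -- the summable majorant `M k = D (k+1)^{2d} e^{−(K₂/2) k}`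
  set D : ℝ := (d : ℝ) * 2 ^ d * B with hD
  have hD0 : 0 ≤ D := by rw [hD]; positivity
  set g : ℕ → ℝ := fun m => (m : ℝ) ^ (2 * d) * Real.exp (-(K₂ / 2) * m) with hg
  have hg_sum : Summable g := Real.summable_pow_mul_exp_neg_nat_mul (2 * d) (half_pos hK₂)
  set M : ℕ → ℝ := fun k => D * Real.exp (K₂ / 2) * g (k + 1) with hM
  have hM_sum : Summable M := ((summable_nat_add_iff 1).2 hg_sum).mul_left _
  have hM0 : ∀ k, 0 ≤ M k := fun k => by simp only [hM, hg]; positivity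
  -- termwise domination of the received-sum series by `M`
  have hterm : ∀ k : ℕ, ((d * (2 * k + 1) ^ d : ℕ) : ℝ) * κ k ≤ M k := by
    intro k
    have h1 : ((2 * k + 1 : ℕ) : ℝ) ^ d ≤ (2 : ℝ) ^ d * ((k + 1 : ℕ) : ℝ) ^ d := by
      rw [← mul_pow]
      exact pow_le_pow_left₀ (by positivity) (by push_cast; linarith) d
    have h2 : Real.exp (-(K₂ / 2) * k) = Real.exp (K₂ / 2) * Real.exp (-(K₂ / 2) * ((k + 1 : ℕ) : ℝ)) := by
      rw [← Real.exp_add]; congr 1; push_cast; ring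
    have h3 : ((k + 1 : ℕ) : ℝ) ^ d * ((k + 1 : ℕ) : ℝ) ^ d = ((k + 1 : ℕ) : ℝ) ^ (2 * d) := by
      rw [← pow_add]; congr 1; ring
    simp only [hM, hg, hD, hκ]
    push_cast
    have hk1 : (0 : ℝ) ≤ (k : ℝ) + 1 := by positivity
    calc ((d : ℝ) * (2 * (k : ℝ) + 1) ^ d) * (B * ((k : ℝ) + 1) ^ d * Real.exp (-(K₂ / 2) * k))
        ≤ ((d : ℝ) * ((2 : ℝ) ^ d * ((k : ℝ) + 1) ^ d)) * (B * ((k : ℝ) + 1) ^ d * Real.exp (-(K₂ / 2) * k)) := by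
          refine mul_le_mul_of_nonneg_right (mul_le_mul_of_nonneg_left ?_ (Nat.cast_nonneg d)) (by positivity)
          have := h1; push_cast at this; exact this
      _ = (d : ℝ) * 2 ^ d * B * Real.exp (K₂ / 2) *
            (((k : ℝ) + 1) ^ (2 * d) * Real.exp (-(K₂ / 2) * ((k : ℝ) + 1))) := by
          have e2 : Real.exp (-(K₂ / 2) * k) = Real.exp (K₂ / 2) * Real.exp (-(K₂ / 2) * ((k : ℝ) + 1)) := by
            rw [← Real.exp_add]; congr 1; ring
          have e3 : ((k : ℝ) + 1) ^ d * ((k : ℝ) + 1) ^ d = ((k : ℝ) + 1) ^ (2 * d) := by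
            rw [← pow_add]; congr 1; ring
          rw [e2, ← e3]; ring
      _ = _ := by ring
  refine ⟨κ, ∑' k, M k, hκ0, fun j hj => ?_, fun j hj => ?_, tsum_nonneg hM0, fun n => ?_⟩
  · -- near shells: `κ j ≥ 2`
    simp only [hκ]
    have hj' : (j : ℝ) ≤ 4 := by exact_mod_cast hj
    have hpow : (1 : ℝ) ≤ ((j + 1 : ℕ) : ℝ) ^ d := one_le_pow₀ (by push_cast; linarith)
    have hexp : Real.exp (2 * K₂) * Real.exp (-(K₂ / 2) * j) ≥ 1 := by
      rw [← Real.exp_add]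
      exact Real.one_le_exp (by nlinarith)
    calc (2 : ℝ) ≤ 2 * Real.exp (2 * K₂) * 1 * Real.exp (-(K₂ / 2) * j) := by nlinarith [Real.exp_pos (-(K₂ / 2) * j)]
      _ ≤ B * ((j + 1 : ℕ) : ℝ) ^ d * Real.exp (-(K₂ / 2) * j) := by
          refine mul_le_mul_of_nonneg_right (mul_le_mul hB2 hpow zero_le_one hB0) (Real.exp_nonneg _)
  · -- far shells: Cor. 7.4's bound with `r = ⌊(j−1)/4⌋`
    set r : ℕ := (j - 1) / 4 with hr
    have h4r : 4 * r + 1 ≤ j + 1 := by omega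
    have h4r' : j ≤ 4 * r + 4 := by omega
    simp only [hκ]
    have hpow : ((d * (4 * r + 1) ^ d : ℕ) : ℝ) ≤ (d : ℝ) * ((j + 1 : ℕ) : ℝ) ^ d := by
      have : (d * (4 * r + 1) ^ d : ℕ) ≤ d * (j + 1) ^ d :=
        Nat.mul_le_mul_left d (Nat.pow_le_pow_left h4r d)
      exact_mod_cast this
    have hexp : Real.exp (-(K₂ * (2 * (r : ℕ)))) ≤ Real.exp (2 * K₂) * Real.exp (-(K₂ / 2) * j) := by
      rw [← Real.exp_add]
      refine Real.exp_le_exp.2 ?_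
      have : (j : ℝ) ≤ 4 * r + 4 := by exact_mod_cast h4r'
      nlinarith
    calc E₀ * (2 * (((d * (4 * r + 1) ^ d : ℕ) : ℝ) * (E₀ * (K₁ * Real.exp (-(K₂ * (2 * (r : ℕ))))))))
        = 2 * (E₀ * E₀) * K₁ * (((d * (4 * r + 1) ^ d : ℕ) : ℝ)) * Real.exp (-(K₂ * (2 * (r : ℕ)))) := by ring
      _ ≤ 2 * (E₀ * E₀) * K₁ * ((d : ℝ) * ((j + 1 : ℕ) : ℝ) ^ d) *
            (Real.exp (2 * K₂) * Real.exp (-(K₂ / 2) * j)) :=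
          mul_le_mul (mul_le_mul_of_nonneg_left hpow (by positivity)) hexp (Real.exp_nonneg _) (by positivity)
      _ = (2 * d * (E₀ * E₀) * K₁ * Real.exp (2 * K₂)) * ((j + 1 : ℕ) : ℝ) ^ d * Real.exp (-(K₂ / 2) * j) := by
          ring
      _ ≤ B * ((j + 1 : ℕ) : ℝ) ^ d * Real.exp (-(K₂ / 2) * j) := by
          refine mul_le_mul_of_nonneg_right (mul_le_mul_of_nonneg_right ?_ (by positivity)) (Real.exp_nonneg _)
          rw [hB]
          refine mul_le_mul_of_nonneg_right (by linarith) (Real.exp_nonneg _)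
  · -- the partial sums are bounded by the sum of the majorant
    calc ∑ k ∈ Finset.range (n + 1), ((d * (2 * k + 1) ^ d : ℕ) : ℝ) * κ k
        ≤ ∑ k ∈ Finset.range (n + 1), M k := Finset.sum_le_sum fun k _ => hterm k
      _ ≤ ∑' k, M k := hM_sum.sum_le_tsum _ fun k _ => hM0 k

/-! ### §2 Uniqueness of the slab Gibbs measure at every large height -/

section Slab

variable {d N : ℕ} {G : Type*} [Group G] [TopologicalSpace G] [IsTopologicalGroup G]
  [CompactSpace G] [MeasurableSpace G] [BorelSpace G] [SecondCountableTopology G] [T2Space G] [NeZero d]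
  (ρ : G →* Matrix (Fin N) (Fin N) ℂ)

/-- ★ **Chatterjee 2021, §12 ¶1 — exponential decay of correlations under arbitrary boundary conditions makes the
slab Gibbs measure unique, for every boundary condition, at every large slab height** («for any boundary condition
on the infinite slab … there is a unique Gibbs measure for our lattice gauge theory on the slab»). Here for EVERY
compact metrisable `G`, continuous `ρ` with `|Re tr ρ(U_p)| ≤ C`, and Def. 2.3 with constants `K₁`, `K₂ > 0`: there
is `n₀` such that `slabGibbsMeasures ρ β n δ` is a subsingleton for all `n ≥ n₀` and all `δ`. Proof:
Dobrushin–Shlosman's window comparison under the averaged condition `C_V` with frozen temporal faces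
(`DobrushinShlosman.measure_eq_of_frozen_dlr_window_bulk`) for the system of all full-height cubes of side `n` of
the slab (every interior link a centre), weight `r ≡ 1`: (H1) and locality from
`abs_integral_sub_integral_le_cube_influence` / `integral_ymSpecification_cube_congr`, the averaged received sum from
`sum_cover_boundary_influence_le` against `le_card_cover`, the exhaustion from `exists_slab_exhaustion_profile`.
[cite: Chatterjee2021, Thm. 2.4 (proof, §12 ¶1)] -/
theorem subsingleton_slabGibbsMeasures_of_strongExpDecayZd (hρ : Continuous ρ) {C : ℝ} (hC0 : 0 ≤ C)
    (hC : ∀ (x : Site d) (i j : Fin d) (U : LGConfig d G), |plaquetteObs ρ x i j U| ≤ C)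
    {β K₁ K₂ : ℝ} (hdecay : StrongExpDecayZd d ρ β K₁ K₂) (hK₂ : 0 < K₂) :
    ∃ n₀ : ℕ, 1 ≤ n₀ ∧ ∀ n, n₀ ≤ n → ∀ δ : LGConfig d G, (slabGibbsMeasures ρ β n δ).Subsingleton := by
  classical
  have hd : 0 < d := Nat.pos_of_ne_zero (NeZero.ne d)
  have hK₁ : 0 ≤ K₁ := hdecay.nonneg
  -- the influence profile
  set E₀ : ℝ := Real.exp (2 * (|β| * (2 * C * (2 * (d - 1 : ℕ) : ℕ)))) with hE₀
  obtain ⟨κ, A, hκ0, hκ2, hκE, hA0, hA⟩ :=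
    exists_influence_profile (d := d) E₀ K₁ K₂ (Real.exp_nonneg _) hK₁ hK₂
  -- the height threshold
  set M₀ : ℝ := 4 * d * ((d - 1 : ℕ) : ℝ) * 2 ^ (d - 1) * A with hM₀
  have hM₀0 : 0 ≤ M₀ := by rw [hM₀]; positivity
  refine ⟨⌈M₀⌉₊ + 3, by omega, fun n hn δ => ?_⟩
  have hn3 : 3 ≤ n := by omega
  have hn2 : 2 ≤ n := by omega
  have hn1 : 1 ≤ n := by omega
  have hnM : M₀ ≤ (n : ℝ) - 1 := by
    have h1 : (⌈M₀⌉₊ : ℝ) + 3 ≤ n := by exact_mod_cast hn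
    have h2 : M₀ ≤ ⌈M₀⌉₊ := Nat.le_ceil M₀
    linarith
  -- metric bookkeeping on `G` (`val = id`, Urysohn's metric, bounded by compactness)
  letI mG : MetricSpace G := TopologicalSpace.metrizableSpaceMetric G
  obtain ⟨Dm, hDm⟩ : ∃ Dm : ℝ, ∀ a b : G, dist a b ≤ Dm := by
    obtain ⟨Dm, hDm⟩ := (isCompact_univ (X := G)).isBounded.subset_closedBall (1 : G)
    refine ⟨Dm + Dm, fun a b => ?_⟩
    have ha := hDm (Set.mem_univ a)
    have hb := hDm (Set.mem_univ b)
    rw [Metric.mem_closedBall] at ha hb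
    calc dist a b ≤ dist a 1 + dist 1 b := dist_triangle _ _ _
      _ ≤ Dm + Dm := by rw [dist_comm 1 b]; exact add_le_add ha hb
  have hDm0 : 0 ≤ Dm := dist_nonneg.trans (hDm 1 1)
  -- the window system of all full-height cubes of side `n`
  let cubeInt : ZdEdge d → Finset (ZdEdge d) := fun c => (((Fintype.piFinset fun j : Fin d =>
      Finset.Icc ((fun j : Fin d => if j = 0 then (0 : ℤ) else c.1 j - 1) j)
        ((fun j : Fin d => if j = 0 then (0 : ℤ) else c.1 j - 1) j + n)) ×ˢ
      (Finset.univ : Finset (Fin d))).filter fun e =>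
        e.1 e.2 + 1 ≤ (fun j : Fin d => if j = 0 then (0 : ℤ) else c.1 j - 1) e.2 + n ∧
        ∀ j, j ≠ e.2 → (fun j : Fin d => if j = 0 then (0 : ℤ) else c.1 j - 1) j < e.1 j ∧
          e.1 j < (fun j : Fin d => if j = 0 then (0 : ℤ) else c.1 j - 1) j + n)
  let cubeEdges : ZdEdge d → Finset (ZdEdge d) := fun c => (((Fintype.piFinset fun j : Fin d =>
      Finset.Icc ((fun j : Fin d => if j = 0 then (0 : ℤ) else c.1 j - 1) j)
        ((fun j : Fin d => if j = 0 then (0 : ℤ) else c.1 j - 1) j + n)) ×ˢ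
      (Finset.univ : Finset (Fin d))).filter fun e =>
        e.1 e.2 + 1 ≤ (fun j : Fin d => if j = 0 then (0 : ℤ) else c.1 j - 1) e.2 + n)
  let win : ZdEdge d → Finset (ZdEdge d) := fun c => if IsSlabInteriorEdge n c then cubeInt c else ∅
  let nbhd : ZdEdge d → Finset (ZdEdge d) := fun c => if IsSlabInteriorEdge n c then cubeEdges c else ∅
  let K : ZdEdge d → ZdEdge d → ZdEdge d → ℝ := fun c y x =>
    if IsSlabInteriorEdge n c ∧ x ∈ cubeInt c ∧ y ∉ cubeInt c ∧ y ∈ cubeEdges c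
    then κ ⌊‖x.1 - y.1‖⌋₊ else 0
  let cover : ZdEdge d → Finset (ZdEdge d) := fun x => ((Fintype.piFinset fun j : Fin d =>
      if j = 0 then Finset.Icc (0 : ℤ) n else Finset.Icc (x.1 j + 1 - n) (x.1 j + 1)) ×ˢ
    (Finset.univ : Finset (Fin d))).filter fun c => IsSlabInteriorEdge n c ∧ x ∈ win c
  have hwin_pos : ∀ c, IsSlabInteriorEdge n c → win c = cubeInt c := fun c hc => if_pos hc
  have hnbhd_pos : ∀ c, IsSlabInteriorEdge n c → nbhd c = cubeEdges c := fun c hc => if_pos hc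
  have hwin_neg : ∀ c, ¬ IsSlabInteriorEdge n c → win c = ∅ := fun c hc => if_neg hc
  have hint_sub_edges : ∀ c, cubeInt c ⊆ cubeEdges c := by
    intro c u hu
    simp only [cubeInt, cubeEdges, Finset.mem_filter] at hu ⊢
    exact ⟨hu.1, hu.2.1⟩
  have hKwin : ∀ c y x, K c y x ≠ 0 → IsSlabInteriorEdge n c ∧ x ∈ win c ∧ y ∈ nbhd c ∧ y ∉ win c := by
    intro c y x hK
    by_cases h : IsSlabInteriorEdge n c ∧ x ∈ cubeInt c ∧ y ∉ cubeInt c ∧ y ∈ cubeEdges c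
    · rw [hwin_pos c h.1, hnbhd_pos c h.1]
      exact ⟨h.1, h.2.1, h.2.2.2, h.2.2.1⟩
    · exact absurd (if_neg h) hK
  -- the specification and the two measures
  have hγ := QuantumFieldTheory.isSpecification_ymSpecification_of_t2Space (d := d) ρ hρ β
  intro μ hμ ν hν
  haveI := hμ.1.1
  haveI := hν.1.1
  -- constant observables have equal averages under any two kernels
  have hconst : ∀ (Λ : Finset (ZdEdge d)) (ζ ζ' : LGConfig d G) (f : LGConfig d G → ℝ),
      DependsOn f ((∅ : Finset (ZdEdge d)) : Set (ZdEdge d)) →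
      ∫ U, f U ∂(ymSpecification ρ β Λ ζ) = ∫ U, f U ∂(ymSpecification ρ β Λ ζ') := by
    intro Λ ζ ζ' f hf
    haveI := hγ.isProbability Λ ζ
    haveI := hγ.isProbability Λ ζ'
    have hc : ∀ U, f U = f ζ := fun U => hf (by simp)
    rw [show (fun U => f U) = fun _ => f ζ from funext hc]
    simp
  refine measure_eq_of_frozen_dlr_window_bulk hγ (r := fun _ _ => (1 : ℝ)) (R := 1)
    (fun _ _ => zero_le_one) (fun _ _ => le_rfl) zero_le_one (win := win) (nbhd := nbhd) (K := K)
    ?hK0 ?hKsupp ?hcontract ?hloc (W := {e | IsSlabInteriorEdge n e}) ?hself cover ?hcover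
    (γ₀ := 1 / 2) (Γ := (2 * d * (d - 1) * (n + 1) ^ (d - 1) : ℕ) * A) (by norm_num) (by norm_num)
    (by positivity) ?hsum0 ?hsum ?hexh (val := id) (by rw [MeasurableSpace.comap_id]) hDm0
    (fun a b => by simpa using hDm a b) δ hμ.2 hν.2 (dlr_ymSpecification_of_mem_slabGibbsMeasures ρ hμ)
    (dlr_ymSpecification_of_mem_slabGibbsMeasures ρ hν)
  case hK0 =>
    intro c y x
    simp only [K]
    split_ifs
    · exact hκ0 _
    · exact le_rfl
  case hKsupp =>
    intro c y x hK
    exact (hKwin c y x hK).2.2.1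
  case hcontract =>
    intro c y hy ω η hωη f δ' hfm hfB hfdep hδ0 hlip
    rw [mul_one]
    obtain ⟨B, hB⟩ := hfB
    have hlip' : ∀ (x : ZdEdge d) (σ τ : LGConfig d G), (∀ e, e ≠ x → σ e = τ e) → |f σ - f τ| ≤ δ' x :=
      fun x σ τ h => by simpa using hlip x σ τ h
    by_cases hc : IsSlabInteriorEdge n c
    · rw [hwin_pos c hc] at hy hfdep ⊢
      have key := abs_integral_sub_integral_le_cube_influence ρ hρ hC0 hC hdecay hK₂.le n
        (fun j : Fin d => if j = 0 then (0 : ℤ) else c.1 j - 1) (cubeInt c) rfl κ hκ0 hκ2 hκE y hy ω η hωη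
        hfm hB hfdep hδ0 hlip'
      refine key.trans (le_of_eq (Finset.sum_congr rfl fun x hx => ?_))
      congr 1
      simp only [K]
      by_cases hyE : y ∈ cubeEdges c
      · have hyE' : (∀ j, (fun j : Fin d => if j = 0 then (0 : ℤ) else c.1 j - 1) j ≤ y.1 j ∧
            y.1 j ≤ (fun j : Fin d => if j = 0 then (0 : ℤ) else c.1 j - 1) j + n) ∧
            y.1 y.2 + 1 ≤ (fun j : Fin d => if j = 0 then (0 : ℤ) else c.1 j - 1) y.2 + n := by
          simpa only [cubeEdges, Finset.mem_filter, Finset.mem_product, Fintype.mem_piFinset, Finset.mem_Icc,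
            Finset.mem_univ, and_true] using hyE
        rw [if_pos hyE', if_pos ⟨hc, hx, hy, hyE⟩]
      · have hyE' : ¬ ((∀ j, (fun j : Fin d => if j = 0 then (0 : ℤ) else c.1 j - 1) j ≤ y.1 j ∧
            y.1 j ≤ (fun j : Fin d => if j = 0 then (0 : ℤ) else c.1 j - 1) j + n) ∧
            y.1 y.2 + 1 ≤ (fun j : Fin d => if j = 0 then (0 : ℤ) else c.1 j - 1) y.2 + n) := by
          simpa only [cubeEdges, Finset.mem_filter, Finset.mem_product, Fintype.mem_piFinset, Finset.mem_Icc,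
            Finset.mem_univ, and_true] using hyE
        rw [if_neg hyE', if_neg (fun h => hyE h.2.2.2)]
    · rw [hwin_neg c hc] at hfdep ⊢
      rw [hconst _ ω η f hfdep, sub_self, abs_zero, Finset.sum_empty]
  case hloc =>
    intro c ζ ζ' hζ f hfm hfB hfdep
    by_cases hc : IsSlabInteriorEdge n c
    · rw [hwin_pos c hc] at hfdep ⊢
      rw [hnbhd_pos c hc] at hζ
      refine integral_ymSpecification_cube_congr ρ hρ β rfl hfm hfdep fun u hu1 hu2 => hζ u ?_
      simp only [cubeEdges, Finset.mem_filter, Finset.mem_product, Fintype.mem_piFinset, Finset.mem_Icc,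
        Finset.mem_univ, and_true]
      exact ⟨hu1, hu2⟩
    · rw [hwin_neg c hc] at hfdep ⊢
      exact hconst _ ζ ζ' f hfdep
  case hself =>
    intro c hc
    rw [hwin_pos c hc]
    exact self_mem_cubeInterior_base hn2 hc rfl
  case hcover =>
    intro c x
    exact mem_cover_iff n win cover (fun c => rfl) (fun x => rfl) c x
  case hsum0 =>
    intro x
    have h := sum_cover_boundary_influence_le hκ0 n x win nbhd cover K hwin_pos hnbhd_pos
      (fun c y hc hxc hyc => by
        rw [hwin_pos c hc] at hxc ⊢
        rw [hnbhd_pos c hc] at hyc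
        simp only [K]
        by_cases hyi : y ∈ cubeInt c
        · rw [if_neg (fun h => h.2.2.1 hyi), if_neg (not_not.2 hyi)]
        · rw [if_pos ⟨hc, hxc, hyi, hyc⟩, if_pos hyi]) rfl
    refine (le_of_eq ?_).trans (h.trans (mul_le_mul_of_nonneg_left (hA n) (Nat.cast_nonneg _)))
    rfl
  case hsum =>
    intro x
    have h := sum_cover_boundary_influence_le hκ0 n x win nbhd cover K hwin_pos hnbhd_pos
      (fun c y hc hxc hyc => by
        rw [hwin_pos c hc] at hxc ⊢
        rw [hnbhd_pos c hc] at hyc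
        simp only [K]
        by_cases hyi : y ∈ cubeInt c
        · rw [if_neg (fun h => h.2.2.1 hyi), if_neg (not_not.2 hyi)]
        · rw [if_pos ⟨hc, hxc, hyi, hyc⟩, if_pos hyi]) rfl
    by_cases hxW : IsSlabInteriorEdge n x
    · -- the averaged bound against the number of windows around `x`
      have hcard := le_card_cover hn2 win cover (fun c => rfl) (fun x => rfl) hxW
      refine (le_of_eq rfl).trans (h.trans ((mul_le_mul_of_nonneg_left (hA n) (Nat.cast_nonneg _)).trans ?_))
      have hcard' : (((n - 1) ^ d : ℕ) : ℝ) ≤ (cover x).card := by exact_mod_cast hcard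
      refine le_trans ?_ (mul_le_mul_of_nonneg_left hcard' (by norm_num))
      -- `2d(d−1)(n+1)^{d−1} A ≤ (n−1)^d / 2` for `n − 1 ≥ 2^{d+1} d (d−1) A`, `n ≥ 3`
      have hn1' : (1 : ℝ) ≤ n := by exact_mod_cast hn1
      have e1 : (((n - 1) ^ d : ℕ) : ℝ) = ((n : ℝ) - 1) ^ d := by
        rw [Nat.cast_pow, Nat.cast_sub hn1]; push_cast; ring
      rw [e1]
      obtain ⟨d', hd'⟩ : ∃ d', d = d' + 1 := ⟨d - 1, by omega⟩
      have hdsub : d - 1 = d' := by omega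
      rw [hdsub]
      push_cast
      rw [hd', pow_succ]
      have hn3' : (3 : ℝ) ≤ n := by exact_mod_cast hn3
      have h2 : ((n : ℝ) + 1) ^ d' ≤ (2 : ℝ) ^ d' * ((n : ℝ) - 1) ^ d' := by
        rw [← mul_pow]
        exact pow_le_pow_left₀ (by positivity) (by linarith) d'
      have h3 : 0 ≤ ((n : ℝ) - 1) ^ d' := pow_nonneg (by linarith) d'
      have hd'c : ((d' + 1 : ℕ) : ℝ) = (d' : ℝ) + 1 := by push_cast; ring
      rw [hM₀, hdsub, hd'] at hnM
      have h4 : 2 * ((d' : ℝ) + 1) * (d' : ℝ) * ((n : ℝ) + 1) ^ d' * A ≤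
          2 * ((d' : ℝ) + 1) * (d' : ℝ) * ((2 : ℝ) ^ d' * ((n : ℝ) - 1) ^ d') * A :=
        mul_le_mul_of_nonneg_right (mul_le_mul_of_nonneg_left h2 (by positivity)) hA0
      push_cast at hnM
      have h5 : 2 * ((d' : ℝ) + 1) * (d' : ℝ) * ((2 : ℝ) ^ d' * ((n : ℝ) - 1) ^ d') * A =
          (4 * ((d' : ℝ) + 1) * (d' : ℝ) * 2 ^ d' * A) * ((n : ℝ) - 1) ^ d' / 2 := by ring
      rw [hd'c]
      calc 2 * ((d' : ℝ) + 1) * (d' : ℝ) * ((n : ℝ) + 1) ^ d' * A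
          ≤ (4 * ((d' : ℝ) + 1) * (d' : ℝ) * 2 ^ d' * A) * ((n : ℝ) - 1) ^ d' / 2 := h4.trans (le_of_eq h5)
        _ ≤ ((n : ℝ) - 1) * ((n : ℝ) - 1) ^ d' / 2 := by
            have := mul_le_mul_of_nonneg_right hnM h3
            linarith
        _ = 1 / 2 * (((n : ℝ) - 1) ^ d' * ((n : ℝ) - 1)) := by ring
    · -- a link outside the free region lies in no window
      have hempty : cover x = ∅ := by
        refine Finset.eq_empty_of_forall_notMem fun c hc => hxW ?_
        have hxc : x ∈ win c := (mem_cover_iff n win cover (fun c => rfl) (fun x => rfl) c x).2 hc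
        by_cases hc : IsSlabInteriorEdge n c
        · rw [hwin_pos c hc] at hxc
          exact isSlabInteriorEdge_of_mem_cubeInterior (v := fun j : Fin d =>
            if j = 0 then (0 : ℤ) else c.1 j - 1) (by simp) rfl hxc
        · rw [hwin_neg c hc] at hxc
          exact absurd hxc (Finset.notMem_empty x)
      rw [hempty]
      simp
  case hexh =>
    intro Δ hΔ L₀
    exact exists_slab_exhaustion_profile hn1 win nbhd K (fun c => rfl) (fun c => rfl)
      (fun c y x hK => ⟨(hKwin c y x hK).2.1, (hKwin c y x hK).2.2.1⟩) Δ hΔ L₀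

/-! ### §3 Chatterjee's Theorem 2.4, first assertion -/

/-- ★★ **Chatterjee 2021, Theorem 2.4 (first assertion), for every compact gauge group**: «Suppose that [the
lattice gauge theory] satisfies exponential decay of correlations under arbitrary boundary conditions, according to
Definition 2.3. Then it has unbroken center symmetry» — `HasStrongExpDecayZd d ρ β → CentreUnbroken d ρ β`
(Def. 2.3 ⇒ Def. 2.1) for every compact metrisable `G`, every continuous `ρ`, every `d ≥ 1` and every `β`.
Proof: at a large slab height the slab theory has at most one Gibbs measure under every boundary condition
(`subsingleton_slabGibbsMeasures_of_strongExpDecayZd`), and «uniqueness of the Gibbs measure trivially implies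
that center symmetry cannot be spontaneously broken» (`slabCentreUnbroken_of_subsingleton`). With the tree's
Theorem 2.2 (`chatterjee2021_confinement_of_centreUnbroken_holds`): Def. 2.3 ⇒ confinement.
[cite: Chatterjee2021, Thm. 2.4] -/
theorem centreUnbroken_of_hasStrongExpDecayZd (hρ : Continuous ρ) {β : ℝ} (h : HasStrongExpDecayZd d ρ β) :
    CentreUnbroken d ρ β := by
  obtain ⟨K₁, K₂, -, hK₂, hdecay⟩ := h
  obtain ⟨C, hC0, hC⟩ := exists_forall_abs_plaquetteObs_le (d := d) ρ hρ
  obtain ⟨n₀, hn₀, hsub⟩ := subsingleton_slabGibbsMeasures_of_strongExpDecayZd ρ hρ hC0 hC hdecay hK₂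
  exact ⟨n₀, hn₀, fun δ => slabCentreUnbroken_of_subsingleton ρ hρ hn₀ (hsub n₀ le_rfl δ)⟩

/-- **Four-dimensional form** (the hypothesis schema used by the Yang–Mills routes): `HasStrongExpDecay ρ β →
CentreUnbroken 4 ρ β`. [cite: Chatterjee2021, Thm. 2.4] -/
theorem centreUnbroken_of_hasStrongExpDecay {G : Type*} [Group G] [TopologicalSpace G] [IsTopologicalGroup G]
    [CompactSpace G] [MeasurableSpace G] [BorelSpace G] [SecondCountableTopology G] [T2Space G]
    (ρ : G →* Matrix (Fin N) (Fin N) ℂ) (hρ : Continuous ρ) {β : ℝ} (h : HasStrongExpDecay ρ β) :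
    CentreUnbroken 4 ρ β :=
  centreUnbroken_of_hasStrongExpDecayZd ρ hρ h

end Slab

end Literature.MathematicalPhysics.QuantumLattice

end
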